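import Summits.ValiantsHypothesis.ValiantsHypothesis.Theorems.MonotoneRestorationOrbitRestorationQPRowColSupport
import Summits.ValiantsHypothesis.ValiantsHypothesis.Theorems.MonotoneRestorationOrbitRestorationQPRankBoundBridge
import HarnessLib

/-!
# Row and column supports of the factors of a matrix-symmetric affine product (ORBIT currency, ΠΣ sub-rung)

Route MonotoneRestoration, crux `OrbitRestorationQP` (stmt-ValiantsHypothesis-18293), line `depth-three-rung`,
stub A₁ `stub_piSigmaValue`, namespace `Summit.ValiantsHypothesis.ValiantsHypothesis.Theorems.LocalFactors`.

THEOREM L (`AffineFactors.exists_support_of_mem_factors`: every factor of a DIAGONALLY invariant product of fewer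
than `C(n,k)` affine forms is fixed by the pointwise stabiliser of fewer than `k` indices) for a LOCAL position
action — in particular for the pure ROW and the pure COLUMN action — and its packaging with the canonical row /
column supports of `RowColSupport.exists_rowColSupports`, which is the data rule M2′ of the crux workfile
`Cruxes/OrbitRestorationQP/PISIGMA-SUBRUNG.md` keys by:

* `exists_assoc_mem_of_vact` — unique factorisation: a position renaming fixing `f = a · Π L` maps every
  degree-one factor to a unit multiple of a factor;
* `exists_support_of_mem_factors_local` — THEOREM L for a local action `g` (`IsLocal g`; rows, columns):
  every factor of a `g`-invariant product of `< C(n,k)` affine forms is fixed by the `g`-action of the pointwise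
  stabiliser of some `Y`, `|Y| < k` (Dixon–Mortimer 5.2B on the line stabiliser, perfectness, affine upgrade —
  all from `ProductAction`);
* **`exists_rowColSupports_of_matrixSymmetric`** — for a product invariant under the pure row AND the pure
  column action (matrix symmetry): row and column supports `R, C` (unit-invariant, row/column/diagonally
  equivariant) with, for every factor `ℓ ∈ L`, `|R ℓ| < k`, `|C ℓ| < k`, the row permutations fixing `R ℓ`
  pointwise fix `ℓ`, the column permutations fixing `C ℓ` pointwise fix `ℓ`, and the DIAGONAL permutations
  fixing `R ℓ ∪ C ℓ` pointwise fix `ℓ` — i.e. `supp := R ∪ C` satisfies (S1)–(S4) of the keyed-block theorem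
  with `2k - 2` in place of `k`.

Everything is proved. [folklore]

## References
* J. D. Dixon, B. Mortimer, *Permutation Groups*, Springer GTM 163 (1996), Thm 5.2B. [DixonMortimer1996]
* A. Dawar, G. Wilsenach, *Symmetric arithmetic circuits*, ToC 21 (2025), Def. 6.1. [DawarWilsenach2025]
-/

noncomputable section

open scoped Classical Pointwise

-- `Summit.ValiantsHypothesis.ValiantsHypothesis.…` is the tree's single-conjunct layout (Sub = Summit).
set_option linter.dupNamespace false

namespace Summit.ValiantsHypothesis.ValiantsHypothesis.Theorems

namespace LocalFactors

open MvPolynomial Equiv Finset ProductAction RankDistance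

variable {n : ℕ} {K : Type} [Field K]

/-! ### Unique factorisation for a position action -/

/-- Renaming by a permutation of the positions preserves the total degree. [folklore] -/
theorem totalDegree_vact (g : Perm (Fin n) →* Perm (Fin n × Fin n)) (ρ : Perm (Fin n))
    (q : MvPolynomial (Fin n × Fin n) K) : (vact (K := K) g ρ q).totalDegree = q.totalDegree := by
  rw [vact_apply]
  refine le_antisymm (totalDegree_rename_le _ _) ?_
  have h := totalDegree_rename_le (f := ⇑(g ρ).symm) (rename (⇑(g ρ)) q)
  rwa [rename_rename, Equiv.symm_comp_self, rename_id] at h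

/-- A member of `L` is nonzero when `a · Π L ≠ 0`. [folklore] -/
theorem ne_zero_of_mem {L : Multiset (MvPolynomial (Fin n × Fin n) K)} {a : K}
    (hf0 : C a * L.prod ≠ 0) {ℓ : MvPolynomial (Fin n × Fin n) K} (hℓ : ℓ ∈ L) : ℓ ≠ 0 := by
  rintro rfl
  exact hf0 (by rw [Multiset.prod_eq_zero hℓ, mul_zero])

/-- **Translates of a factor are associates of factors** (position action).  If `f = a · Π L` (affine factors)
is nonzero and invariant under the position action `vact g`, then for every factor `ℓ` of degree `1` and every
`ρ`, `vact g ρ ℓ = u · ℓ'` for some factor `ℓ' ∈ L` and `u ≠ 0`. [folklore] -/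
theorem exists_assoc_mem_of_vact (g : Perm (Fin n) →* Perm (Fin n × Fin n))
    {L : Multiset (MvPolynomial (Fin n × Fin n) K)} {a : K}
    (hL : ∀ ℓ ∈ L, ℓ.totalDegree ≤ 1) (hf0 : C a * L.prod ≠ 0)
    (hfix : ∀ ρ : Perm (Fin n), vact (K := K) g ρ (C a * L.prod) = C a * L.prod)
    {ℓ : MvPolynomial (Fin n × Fin n) K} (hℓ : ℓ ∈ L) (hdeg : ℓ.totalDegree = 1) (ρ : Perm (Fin n)) :
    ∃ ℓ' ∈ L, ∃ u : K, u ≠ 0 ∧ vact (K := K) g ρ ℓ = C u * ℓ' := by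
  set p := vact (K := K) g ρ ℓ with hp
  have hpdeg : p.totalDegree = 1 := by rw [hp, totalDegree_vact, hdeg]
  have hprime : Prime p := RankBoundBridge.prime_of_totalDegree_eq_one hpdeg
  have ha : a ≠ 0 := by rintro rfl; exact hf0 (by rw [map_zero, zero_mul])
  have hdvd : p ∣ C a * L.prod := by
    have h1 : p ∣ vact (K := K) g ρ L.prod := by rw [hp]; exact map_dvd _ (Multiset.dvd_prod hℓ)
    have h2 : vact (K := K) g ρ L.prod ∣ vact (K := K) g ρ (C a * L.prod) := by
      rw [map_mul]; exact dvd_mul_left _ _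
    rw [← hfix ρ]; exact h1.trans h2
  rcases hprime.dvd_or_dvd hdvd with h | h
  · exact absurd (isUnit_of_dvd_unit h ((isUnit_iff_ne_zero.2 ha).map C)) hprime.not_unit
  · obtain ⟨ℓ', hℓ', r, hr⟩ := hprime.exists_mem_multiset_dvd h
    have hℓ'0 : ℓ' ≠ 0 := ne_zero_of_mem hf0 hℓ'
    have hp0 : p ≠ 0 := hprime.ne_zero
    have hr0 : r ≠ 0 := by rintro rfl; exact hℓ'0 (by rw [hr, mul_zero])
    have hdr : r.totalDegree = 0 := by
      have := totalDegree_mul_of_isDomain hp0 hr0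
      rw [← hr, hpdeg] at this
      have := hL ℓ' hℓ'
      omega
    obtain ⟨u, hu⟩ : ∃ u : K, r = C u := ⟨_, (totalDegree_eq_zero_iff_eq_C (p := r)).1 hdr⟩
    have hu0 : u ≠ 0 := by rintro rfl; exact hr0 (by rw [hu, map_zero])
    refine ⟨ℓ', hℓ', u⁻¹, inv_ne_zero hu0, ?_⟩
    rw [hr, hu, mul_comm p, ← mul_assoc, ← map_mul, inv_mul_cancel₀ hu0, map_one, one_mul]

/-! ### THEOREM L for a local action -/

/-- **FACTORS OF AN INVARIANT AFFINE PRODUCT ARE RIGIDLY SUPPORTED (local action).**  Let `g` be a local position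
action (e.g. rows, columns), `n > 8`, `1 ≤ k`, `4k ≤ n`, and `f = a · Π L ≠ 0` a product of fewer than `C(n,k)`
polynomials of total degree `≤ 1`, invariant under `vact g`.  Then every factor `ℓ ∈ L` is fixed by the
`g`-action of every permutation fixing pointwise some set of fewer than `k` indices.
[cite: DixonMortimer1996, Thm 5.2B; DawarWilsenach2025, Def. 6.1] -/
theorem exists_support_of_mem_factors_local {g : Perm (Fin n) →* Perm (Fin n × Fin n)} (hg : IsLocal g)
    {k : ℕ} (hn : 8 < n) (hk : 1 ≤ k) (h4k : 4 * k ≤ n)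
    {L : Multiset (MvPolynomial (Fin n × Fin n) K)} {a : K}
    (hL : ∀ ℓ ∈ L, ℓ.totalDegree ≤ 1) (hcard : Multiset.card L < n.choose k) (hf0 : C a * L.prod ≠ 0)
    (hfix : ∀ ρ : Perm (Fin n), vact (K := K) g ρ (C a * L.prod) = C a * L.prod)
    {ℓ : MvPolynomial (Fin n × Fin n) K} (hℓ : ℓ ∈ L) :
    ∃ Y : Finset (Fin n), Y.card < k ∧ ∀ ρ : Perm (Fin n), (∀ x ∈ Y, ρ x = x) → vact (K := K) g ρ ℓ = ℓ := by
  rcases Nat.lt_or_ge ℓ.totalDegree 1 with h0 | h1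
  · -- a constant factor
    refine ⟨∅, by rw [Finset.card_empty]; omega, fun ρ _ => ?_⟩
    rw [(totalDegree_eq_zero_iff_eq_C (p := ℓ)).1 (by omega), vact_apply, rename_C]
  · have hdeg : ℓ.totalDegree = 1 := le_antisymm (hL ℓ hℓ) h1
    have hℓ0 : ℓ ≠ 0 := ne_zero_of_mem hf0 hℓ
    -- the images of the line of `ℓ` are lines of factors
    set T : Finset (MvPolynomial (Fin n × Fin n) K) := (L.map nrm).toFinset with hT
    have hsub : (Set.range fun ρ : Perm (Fin n) => nrm (vact (K := K) g ρ ℓ)) ⊆ ↑T := by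
      rintro _ ⟨ρ, rfl⟩
      obtain ⟨ℓ', hℓ', u, hu0, hu⟩ := exists_assoc_mem_of_vact g hL hf0 hfix hℓ hdeg ρ
      rw [hT, Finset.mem_coe, Multiset.mem_toFinset]
      refine Multiset.mem_map.2 ⟨ℓ', hℓ', ?_⟩
      dsimp only
      rw [hu]
      exact (nrm_eq_of_associated (associated_unit_mul_left ℓ' (C u) ((isUnit_iff_ne_zero.2 hu0).map C))).symm
    have hfin : (Set.range fun ρ : Perm (Fin n) => nrm (vact (K := K) g ρ ℓ)).Finite :=
      (Finset.finite_toSet _).subset hsub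
    have hlt : (Set.range fun ρ : Perm (Fin n) => nrm (vact (K := K) g ρ ℓ)).ncard < n.choose k := by
      refine lt_of_le_of_lt ?_ hcard
      calc (Set.range fun ρ : Perm (Fin n) => nrm (vact (K := K) g ρ ℓ)).ncard ≤ (↑T : Set _).ncard :=
            Set.ncard_le_ncard hsub (Finset.finite_toSet _)
        _ = T.card := Set.ncard_coe_finset _
        _ ≤ Multiset.card L := by
            rw [hT]; exact (Multiset.toFinset_card_le _).trans (by rw [Multiset.card_map])
    obtain ⟨Y, hYk, hY⟩ := altFixLine_of_ncard_lt (vact (K := K) g) hn hk h4k ℓ hfin hlt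
    have hfixY := fix_of_fixLine (vact (K := K) g) (Y := Y) (by omega) hℓ0 hY
    exact ⟨Y, hYk, symFix_of_altFix_affine hg (by omega) (hL ℓ hℓ) hfixY⟩

/-! ### Matrix-symmetric products: row and column supports of the factors -/

/-- **ROW AND COLUMN SUPPORTS OF THE FACTORS OF A MATRIX-SYMMETRIC AFFINE PRODUCT.**  Let `n > 8`, `1 ≤ k`,
`4k ≤ n`, and `f = a · Π L ≠ 0` a product of fewer than `C(n,k)` polynomials of total degree `≤ 1`, invariant
under the pure ROW action and under the pure COLUMN action of `Sym(Fin n)`.  Then there are row / column support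
functions `R, C : K[x_ij] → Finset (Fin n)` — unit-invariant, row/column-equivariant (`R (row σ q) = σ • R q`,
`R (col τ q) = R q`, `C (col τ q) = τ • C q`, `C (row σ q) = C q`), diagonally equivariant — such that every
factor `ℓ ∈ L` has `|R ℓ| < k`, `|C ℓ| < k`, is fixed by the row permutations fixing `R ℓ` pointwise, by the
column permutations fixing `C ℓ` pointwise, and by the DIAGONAL permutations fixing `R ℓ ∪ C ℓ` pointwise.
[cite: DixonMortimer1996, Thm 5.2B; DawarWilsenach2025, Def. 6.1] -/
theorem exists_rowColSupports_of_matrixSymmetric {k : ℕ} (hn : 8 < n) (hk : 1 ≤ k) (h4k : 4 * k ≤ n)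
    {L : Multiset (MvPolynomial (Fin n × Fin n) K)} {a : K}
    (hL : ∀ ℓ ∈ L, ℓ.totalDegree ≤ 1) (hcard : Multiset.card L < n.choose k) (hf0 : C a * L.prod ≠ 0)
    (hrow : ∀ σ : Perm (Fin n), vact (K := K) rowHom σ (C a * L.prod) = C a * L.prod)
    (hcol : ∀ τ : Perm (Fin n), vact (K := K) colHom τ (C a * L.prod) = C a * L.prod) :
    ∃ R C : MvPolynomial (Fin n × Fin n) K → Finset (Fin n),
      (∀ (q : MvPolynomial (Fin n × Fin n) K) (u : K), u ≠ 0 → R (MvPolynomial.C u * q) = R q) ∧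
      (∀ (q : MvPolynomial (Fin n × Fin n) K) (u : K), u ≠ 0 → C (MvPolynomial.C u * q) = C q) ∧
      (∀ (q : MvPolynomial (Fin n × Fin n) K) (σ : Perm (Fin n)), R (vact (K := K) rowHom σ q) = σ • R q) ∧
      (∀ (q : MvPolynomial (Fin n × Fin n) K) (τ : Perm (Fin n)), R (vact (K := K) colHom τ q) = R q) ∧
      (∀ (q : MvPolynomial (Fin n × Fin n) K) (τ : Perm (Fin n)), C (vact (K := K) colHom τ q) = τ • C q) ∧
      (∀ (q : MvPolynomial (Fin n × Fin n) K) (σ : Perm (Fin n)), C (vact (K := K) rowHom σ q) = C q) ∧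
      (∀ (q : MvPolynomial (Fin n × Fin n) K) (σ : Perm (Fin n)), R (ren σ q) = σ • R q) ∧
      (∀ (q : MvPolynomial (Fin n × Fin n) K) (σ : Perm (Fin n)), C (ren σ q) = σ • C q) ∧
      ∀ ℓ ∈ L, (R ℓ).card < k ∧ (C ℓ).card < k ∧
        (∀ ρ : Perm (Fin n), (∀ x ∈ R ℓ, ρ x = x) → vact (K := K) rowHom ρ ℓ = ℓ) ∧
        (∀ ρ : Perm (Fin n), (∀ x ∈ C ℓ, ρ x = x) → vact (K := K) colHom ρ ℓ = ℓ) ∧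
        (∀ ρ : Perm (Fin n), (∀ x ∈ R ℓ ∪ C ℓ, ρ x = x) → ren ρ ℓ = ℓ) := by
  obtain ⟨R, C, R1, C1, R2, hRcol, C2, hCrow, R3, C3, RS3, CS3⟩ := RowColSupport.exists_rowColSupports (K := K) n
  refine ⟨R, C, R1, C1, R2, hRcol, C2, hCrow, R3, C3, fun ℓ hℓ => ?_⟩
  obtain ⟨Y, hYk, hY⟩ := exists_support_of_mem_factors_local isLocal_rowHom hn hk h4k hL hcard hf0 hrow hℓ
  obtain ⟨Z, hZk, hZ⟩ := exists_support_of_mem_factors_local isLocal_colHom hn hk h4k hL hcard hf0 hcol hℓ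
  obtain ⟨hRY, hRfix⟩ := RS3 ℓ Y (by omega) hY
  obtain ⟨hCZ, hCfix⟩ := CS3 ℓ Z (by omega) hZ
  refine ⟨lt_of_le_of_lt hRY hYk, lt_of_le_of_lt hCZ hZk, hRfix, hCfix, fun ρ hρ => ?_⟩
  rw [ren_eq_row_col, hCfix ρ fun x hx => hρ x (Finset.mem_union_right _ hx),
    hRfix ρ fun x hx => hρ x (Finset.mem_union_left _ hx)]

end LocalFactors

end Summit.ValiantsHypothesis.ValiantsHypothesis.Theorems

end
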